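import Summits.ABC.IUTFork.Cor312SettingMSharpRoutes
import Summits.ABC.IUTFork.Cor312ThetaFiniteMSharp
import HarnessLib

/-!
# [IUTchIII] Corollary 3.12 over the M-LEVEL real log-shells `K_{v̲}`, `v̲ ∈ V̲` — the SHARP Dupuy–Hilado Θ-boxes read off
# ideles ARE hull-sets (`λ_Θ·𝒪_L`, `𝒪_L` off a finite set), and the SUMMAND-ROUTE sharp setting `settingPrVolSharpM`
# (G1-Θ unit P4 of `HOME/staging/w5/w5-d166/g4/G1-THETA-SHAPES.md`, C-lead ruling C-R12 (e) «target #2′»)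

Record file (D-0012) of the abc-iut cell (R2 S-chain team, seat abc-iut-s2-p8; branch C «abc ⇐ S»). TAKES NO SIDE on
[IUTchIII] Cor. 3.12. The M-LEVEL port (carriers the completions `K_{v̲}` at the section places `v̲ ∈ V̲ ≅ V_mod` of
[IUTchI] Def. 3.1 (e), kurims `paper:url-690e7b3c6199` p. 62; Dupuy–Hilado Def. 3.6.1) now has: abc-iut-w5-d166's
presentation `padicPresentationOfInitialDH` (P1, p433804) and field-box pieces (`Cor312FrameVolumePiecesM`, p434705), the
lead's FRAMES-ROUTE sharp setting `settingMSharp` with the Θ-boxes `thetaBoxM t` / sharp regions `sharpBoxM t` / `q`-centre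
`qCentreM tq` READ OFF IDELE BINDERS `t_{Θ,i+1,v̲}`, `t_{q,v̲} ∈ K_{v̲}` (`Cor312SettingMSharp`, p435453), abc-iut-w4-d013's
SUMMAND-ROUTE container and setting `summandPiecesPrM` / `settingPrVolM` (`Cor312SettingPrVolM`, p435693) and the two-routes
bridge (`Cor312SettingMSharpRoutes`, p437121: `settingMSharp` = the field-box twin at the sharp binders, same `thetaLocal`,
`negLogTheta`, `Statement`, provenance as `settingPrVolM` at those binders), and this seat's GENERIC box API for ANY
`PadicPresentation` (`Cor312PilotIdelesPadic`, p434901). THIS file (twin of abc-iut-c312-3's `Cor312PilotIdelesDH` §1/§3,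
p419746, and of abc-iut-c312-7's `Cor312PilotIdelesPr` §1/§3, p422627, and `Cor312PilotIdelesCapstone` §1, p420764):

* §1 the lead's M-level boxes ARE the generic ones at `presAtM` (`labelIdeleM_eq_labelIdele`, `qCentreM_non`, `rfl`; the Θ-side
  `sharpBoxM_eq_sharpBox` / `thetaBoxM_non_eq` are abc-iut-s2-p9's, p437661), hence the BOX CONDITIONS abc-iut-c312-7's `ThetaFinite` lane consumes (abc-iut-s2-p9's generic unit P5
  `thetaFinite_ofFramesM`, p436943 + sequel): every sharp Θ-box is a HULL-SET (`isHullSet_thetaBoxM`: `λ_Θ·𝒪_L` at a finite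
  place — [IUTchIII] Rmk. 3.9.5 (ix): the Θ-pilot object is an arithmetic line bundle —, the hull-set over the EMPTY index at
  `∞`), hence BOUNDED and NONDEGENERATE; it is `𝒪_L` where the Θ-ideles are units (abc-iut-s2-p9 `thetaBoxM_labelSucc_eq_hullSet_one`), so
  off any finite set `Sθ` of rational places off which they are units (`finite_ne_unitBox_thetaBoxM`; for the genuine ideles
  of abc-iut-S2's `ThetaVolumeInput`: the places under `V^bad_mod`, abc-iut-w5-d033's units P4a
  `norm_tThetaM_eq_one_of_not_mem(_Vbad)`, p436273/p436999); `packetLogμ_sharpBoxM_labelSucc` (Dupuy–Hilado (3.7):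
  `log μ̄ = log ‖t_{Θ,i+1,v̲_{i+1}}‖`);
* §2 **`settingPrVolSharpM`** := abc-iut-w4-d013's `settingPrVolM` with EVERY pilot binder supplied from the ideles — the
  lead's `thetaBoxM t` / `qCentreM tq`, `hq := qCentreM_ne_zero`, `hfin := qSupport_finite_PrVolM_sharp` (p437121) —, i.e.
  LITERALLY the summand-route term of the two-routes bridge, so `negLogTheta`/`thetaLocal`/`ThetaFinite`/`Statement`/
  provenance agree with the lead's `settingMSharp` BY NAME (`negLogTheta_settingMSharp_eq_settingPrVolSharpM`, …); then
  the twin of abc-iut-c312-7's §1/§3: `thetaRegion_settingPrVolSharpM` (`rfl`, constant in the Kummer index — Dupuy–Hilado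
  §4.10), `hθ` (`adm_thetaRegion3_settingPrVolSharpM`), **the packet-normalised local Θ-volume in CLOSED FORM**
  `logvol_thetaRegion3_settingPrVolSharpM_non = Σ_{v⃗} Pr(v⃗)·log ‖t_{Θ,i+1,v̲_{i+1}}‖` with the `V_mod` probability weights
  `weightM` ([IUTchIII] Rmk. 3.1.1 (ii); Dupuy–Hilado §3.6/(3.7)), `hfinθ` (support ⊆ `Sθ`), the local `q`-volume
  `logvol_qRegion_settingPrVolSharpM_non = Σ_{v⃗} Pr(v⃗)·log ‖t_{q,v̲_j}‖`, **`bridgeHyps_settingPrVolSharpM`**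
  (abc-iut-c312-6's `BridgeHyps` from `ThetaFinite` ALONE) and — `ThetaFinite` being abc-iut-s2-p9's `thetaFinite_settingMSharp`
  (unit P5b, p437661) carried along the two-routes identity (`thetaFinite_settingPrVolSharpM`) — **`bridgeHyps_settingPrVolSharpM_of_ideles`:
  EVERY field of `BridgeHyps` a theorem**, left only the idele binders (twin of abc-iut-c312-7's `bridgeHyps_settingPrVolSharp_of_ideles`).

[claim: Mochizuki2012, status: disputed] for the quoted setting; [cite: DupuyHilado2025, Def. 3.6.1, §3.4, §3.6, §3.7, §3.9,
§4.10]; [cite: Mochizuki2012, IUTchI Def. 3.1 (e) p. 62; IUTchIII Rmk. 3.1.1 (ii)(iii) p. 94–96, Rmk. 3.9.5 (ii) p. 127, (ix)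
(cQ3) p. 141, Prop. 3.9 (iii) p. 115; IUTchIV Prop. 1.4 (i) p. 13]. HONEST FRAMING: bookkeeping over OUR typed objects at the
genuine carriers; the ideles are BINDERS (abc-iut-w5-d033's `tThetaM`/`tqM` instantiate them at a volume input with every
side condition a theorem); nothing here asserts that Cor. 3.12 holds, nor that the sharp reading is the author's;
the numbers and the comparison with abc-iut-S2's `ThetaVolumeInput.negLogTheta` (unit P6) are
NOT here. typed ≠ proved; an instance ≠ an endorsement.
-/

noncomputable section

open Set Function NumberField IsDedekindDomain
open scoped Pointwise

namespace Summit.ABC.IUTFork.Thm311.Real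

open Cor312 Cor312Vol Literature.IUT.LogThetaLattice Literature.IUT.LogVolume Literature.IUT.HodgeTheaters
  Literature.NumberTheory.NumberFields

variable {F K Fbar : Type} [Field F] [NumberField F] [Field K] [NumberField K] [Algebra F K]
  [Field Fbar] [Algebra F Fbar] [Algebra K Fbar] {E : WeierstrassCurve F} [E.IsElliptic] {l : ℕ}
  {Pb : BadPlacePredicates K} (D : InitialThetaData F K Fbar E l Pb) {logvK : PadicLogsVal K}
  (hlog : LogvAnalyticVal logvK)
  (t : ∀ (u : FinitePlace ℚ) (_ : Fin (thetaIndexOfInitial D).lstar) (x : (thetaIndexOfInitial D).Fibre (Val.non u)),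
    kOfM D (ratChar u) u (natCast_ratChar_mem u) x)
  (tq : ∀ (u : FinitePlace ℚ) (x : (thetaIndexOfInitial D).Fibre (Val.non u)),
    kOfM D (ratChar u) u (natCast_ratChar_mem u) x)

/-! ## §1. The lead's M-level boxes are the generic ones at `presAtM`; the sharp Θ-boxes are hull-sets -/

section Boxes

/-- The lead's label idele IS the generic one of `Cor312PilotIdelesPadic` at `presAtM` (same formula). [folklore] -/
theorem labelIdeleM_eq_labelIdele (u : FinitePlace ℚ) (j : (thetaIndexOfInitial D).Label)
    (x : (thetaIndexOfInitial D).Fibre (Val.non u)) :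
    labelIdeleM D t u j x = (presAtM D hlog u).labelIdele (t u) j x :=
  rfl

/-- At the archimedean place the lead's Θ-box is everything (the trivial archimedean container). [folklore] -/
theorem thetaBoxM_arc (j : (thetaIndexOfInitial D).Label) (w : InfinitePlace ℚ) :
    thetaBoxM D hlog t j (Val.arc w) = Set.univ :=
  rfl

/-- At a finite rational place the lead's `q`-centre is the generic `PadicPresentation.qCentre` at `presAtM`. [folklore] -/
theorem qCentreM_non (j : (thetaIndexOfInitial D).Label) (u : FinitePlace ℚ) :
    qCentreM D hlog tq j (Val.non u) = (presAtM D hlog u).qCentre (tq u) j :=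
  rfl

/-- **(3.7) at the M level**: the log-measure of the sharp region at the label `j = i+1` is `log ‖t_{Θ,i+1,v̲_{i+1}}‖`.
[cite: DupuyHilado2025, §3.4, §3.7] -/
theorem packetLogμ_sharpBoxM_labelSucc (ht0 : ∀ u i x, t u i x ≠ 0) (u : FinitePlace ℚ)
    (i : Fin (thetaIndexOfInitial D).lstar)
    (e : (thetaIndexOfInitial D).Caps (Setting.labelSucc i) → (thetaIndexOfInitial D).Fibre (Val.non u)) :
    packetLogμ (ratChar u) ((presAtM D hlog u).kk e) (sharpBoxM D hlog t u (Setting.labelSucc i) e) =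
      Real.log ‖t u i (e (Fin.last _))‖ :=
  (presAtM D hlog u).packetLogμ_sharpBox_labelSucc (t u) (ht0 u) i e

/-- **At a finite rational place the sharp Θ-box IS the hull-set `λ_Θ·𝒪_L`** of the Θ-centre (this seat's generic
`boxOf_sharpBox`; twin of abc-iut-c312-7's `thetaBoxDH_sharp_inr`). [cite: Mochizuki2012, IUTchIII Rmk. 3.9.5 (ix) (cQ3) p. 141] -/
theorem thetaBoxM_non_eq_hullSet (ht0 : ∀ u i x, t u i x ≠ 0) (j : (thetaIndexOfInitial D).Label) (u : FinitePlace ℚ) :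
    thetaBoxM D hlog t j (Val.non u) =
      hullSet ((presAtM D hlog u).factorField j) ((presAtM D hlog u).thetaCentre (t u) j) :=
  (presAtM D hlog u).boxOf_sharpBox (t u) (ht0 u) j

/-- The factor index at `∞` is empty. [folklore] -/
theorem isEmpty_factorIdxM_arc (j : (thetaIndexOfInitial D).Label) (w : InfinitePlace ℚ) :
    IsEmpty (factorIdxM D hlog j (Val.arc w)) :=
  inferInstanceAs (IsEmpty PEmpty)

/-- **Every sharp Θ-box of the M-level setting is a hull-set**, at every place: `λ_Θ·𝒪_L` at a finite place, the hull-set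
over the EMPTY index (= everything) at `∞` ([IUTchIII] Rmk. 3.9.5 (ix): the Θ-pilot object is an arithmetic line bundle)
— hence BOUNDED and NONDEGENERATE, the first two box conditions of abc-iut-c312-7's `ThetaFinite` lane. Twin of
abc-iut-c312-7's `isHullSet_thetaBoxDH_sharp`. [cite: Mochizuki2012, IUTchIII Rmk. 3.9.5 (ix) (cQ3) p. 141] -/
theorem isHullSet_thetaBoxM (ht0 : ∀ u i x, t u i x ≠ 0) (j : (thetaIndexOfInitial D).Label) :
    ∀ vQ : (thetaIndexOfInitial D).VQ, IsHullSet (factorFieldM D hlog j vQ) (thetaBoxM D hlog t j vQ)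
  | .inl w => by
    haveI := isEmpty_factorIdxM_arc D hlog j w
    show IsHullSet (factorFieldM D hlog j (Val.arc w)) (thetaBoxM D hlog t j (Val.arc w))
    refine ⟨fun s => isEmptyElim s, fun s => isEmptyElim s, ?_⟩
    rw [thetaBoxM_arc]
    exact (Set.eq_univ_of_forall fun y => (mem_polydisc _).2 fun s => isEmptyElim s).symm
  | .inr u => isHullSet_thetaBoxM_non D hlog t ht0 j u

/-- **The finite rational places where the sharp box at `(i+1, ·)` is not `𝒪_L` lie in any finite set `Sθ` off which the
Θ-ideles are units** (for the genuine ideles: the places under `V^bad_mod`, abc-iut-w5-d033 `norm_tThetaM_eq_one_of_not_mem`)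
— the third box condition of the `ThetaFinite` lane. Twin of abc-iut-c312-7's `finite_ne_unitBox_sharp`.
[cite: DupuyHilado2025, §3.9] -/
theorem finite_ne_unitBox_thetaBoxM (ht0 : ∀ u i x, t u i x ≠ 0) (Sθ : Finset (FinitePlace ℚ))
    (ht1 : ∀ (u : FinitePlace ℚ) (i : Fin (thetaIndexOfInitial D).lstar) (x : (thetaIndexOfInitial D).Fibre (Val.non u)),
      u ∉ Sθ → ‖t u i x‖ = 1)
    (i : Fin (thetaIndexOfInitial D).lstar) :
    {u : FinitePlace ℚ | thetaBoxM D hlog t (Setting.labelSucc i) (Val.non u) ≠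
      hullSet (factorFieldM D hlog (Setting.labelSucc i) (Val.non u)) (fun _ => 1)}.Finite := by
  refine Sθ.finite_toSet.subset fun u hu => ?_
  by_contra hS
  exact hu (thetaBoxM_labelSucc_eq_hullSet_one D hlog t ht0 i u fun x => ht1 u i x hS)

end Boxes

/-! ## §2. The SUMMAND-ROUTE sharp setting `settingPrVolSharpM`; `hθ`, the local volumes in closed form, `hfinθ`, `BridgeHyps` -/

section Setting

variable (M : Type) [Field M] [NumberField M]
  (archPk : ∀ (j : (thetaIndexOfInitial D).Label) (vQ : (thetaIndexOfInitial D).VQ),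
    Set ((logShellsOfInitialDH D logvK).Packet j vQ))
  (archSub : ∀ (j : (thetaIndexOfInitial D).Label) (v : (thetaIndexOfInitial D).V),
    Set ((logShellsOfInitialDH D logvK).Packet j ((thetaIndexOfInitial D).over v)))
  (Ψ : ℤ → ∀ v : (thetaIndexOfInitial D).V, v ∈ (thetaIndexOfInitial D).Vbad →
    Set ((logShellsOfInitialDH D logvK).StarPacket v))
  (act : ℤ → ∀ v : (thetaIndexOfInitial D).V, v ∈ (thetaIndexOfInitial D).Vbad →
    (logShellsOfInitialDH D logvK).StarPacket v → Module.End ℚ ((logShellsOfInitialDH D logvK).StarPacket v))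
  (Mmod : ℤ → ∀ j : (thetaIndexOfInitial D).LabelStar, Set ((logShellsOfInitialDH D logvK).GlobalPacket j.1))
  (region : ℤ → ∀ j : (thetaIndexOfInitial D).LabelStar, FinDivisor M → ∀ vQ : (thetaIndexOfInitial D).VQ,
    Set ((logShellsOfInitialDH D logvK).Packet j.1 vQ))
  (n : ℤ) {HT : Type} {LogLink : HT → HT → Type} {IsFull : ∀ {s t : HT}, LogLink s t → Prop}
  (lat : LGPGaussianLogThetaLattice LogLink IsFull)
  {Frd : Type} {IsoF : Frd → Frd → Type} {Ob : Frd → Type} {realify : Frd → Frd} {Strip : Type}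
  {IsoS : Strip → Strip → Type}
  {Mv : ∀ v : (thetaIndexOfInitial D).V, v ∈ (thetaIndexOfInitial D).Vbad → Type} [∀ v h, Monoid (Mv v h)]
  (sig : GlobalLGPFrobenioidSignature (thetaIndexOfInitial D).lstar (thetaIndexOfInitial D).V
    (· ∈ (thetaIndexOfInitial D).Vbad) Frd IsoF Ob realify Strip IsoS Mv)
  (split : SplittingMonoids Mv) {ObΔ : Type}
  {N : ∀ v : (thetaIndexOfInitial D).V, v ∈ (thetaIndexOfInitial D).Vbad → Type} [∀ v h, Monoid (N v h)]
  (qData : QPilotData ObΔ N)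
  (htq0 : ∀ u x, tq u x ≠ 0) (Sq : Finset (FinitePlace ℚ))
  (htq1 : ∀ (u : FinitePlace ℚ) (x : (thetaIndexOfInitial D).Fibre (Val.non u)), u ∉ Sq → ‖tq u x‖ = 1)

/-- The log-volume of the packet-normalised M-level container at the archimedean place is `0` on every region (the
trivial archimedean container, weights `0`; cf. abc-iut-w5-d244's `logvol_summandPiecesPrM_arc`). [folklore] -/
theorem logvol_situationPrVolM_arc (w : InfinitePlace ℚ) (j : (thetaIndexOfInitial D).Label)
    (A : Set ((logShellsOfInitialDH D logvK).Packet j (Val.arc w))) :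
    ((situationPrVolM D hlog M archPk archSub Ψ act Mmod region).D n).logvol j (Val.arc w) A = 0 := by
  show ∑ e, (summandPiecesPrM D hlog).w j (Val.arc w) e * _ = 0
  exact Finset.sum_eq_zero fun e _ => by
    rw [show (summandPiecesPrM D hlog).w j (Val.arc w) e = 0 from rfl, zero_mul]

/-- **The setting of [IUTchIII] Cor. 3.12 over the M-LEVEL real log-shells `K_{v̲}` with the PACKET-NORMALISED verbatim
volumes and the Dupuy–Hilado PILOT REGIONS READ OFF IDELES** (sharp reading), SUMMAND ROUTE: abc-iut-w4-d013's
`settingPrVolM` with the lead's Θ-boxes `ι_j(t_{Θ,j,v̲_j})·(R_I)^∼` and `q`-centre `ψ(ι_j(t_{q,v̲_j}))`, `hq` and `hfin`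
SUPPLIED — the twin of abc-iut-c312-7's `Real.settingPrVolSharp` at the genuine carriers of [IUTchI] Def. 3.1 (e), and
LITERALLY the summand-route term of abc-iut-w4-d013's two-routes bridge (`Cor312SettingMSharpRoutes`). Binders left: the
column `n`, the context data `lat`/`sig`/`split`/`qData`, the archimedean structures and (b)(c) data of the situation, the
ideles `t`, `tq` (`tq` non-zero and units off the finite set `Sq`). [claim: Mochizuki2012, status: disputed] -/
def settingPrVolSharpM : Cor312.Setting (situationPrVolM D hlog M archPk archSub Ψ act Mmod region) :=
  settingPrVolM D hlog M archPk archSub Ψ act Mmod region n lat sig split qData (fun _ _ => thetaBoxM D hlog t)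
    (fun _ => qCentreM D hlog tq) (fun j vQ s => qCentreM_ne_zero D hlog tq htq0 j vQ s)
    (qSupport_finite_PrVolM_sharp D hlog M archPk archSub Ψ act Mmod region n qData tq htq0 Sq htq1)

/-- The column of `settingPrVolSharpM` is `n`. [folklore] -/
theorem settingPrVolSharpM_n :
    (settingPrVolSharpM D hlog t tq M archPk archSub Ψ act Mmod region n lat sig split qData htq0 Sq htq1).n = n :=
  rfl

/-- **The lead's frames-route `−|log(Θ)|` IS the summand-route one** (abc-iut-w4-d013 `negLogTheta_settingMSharp_eq`, read
on `settingPrVolSharpM`): a Θ-side bound (unit P6) proved on either route is a bound on the other.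
[claim: Mochizuki2012, status: disputed] -/
theorem negLogTheta_settingMSharp_eq_settingPrVolSharpM :
    (settingMSharp D hlog M archPk archSub Ψ act Mmod region n lat sig split qData t tq htq0 Sq htq1).negLogTheta =
      (settingPrVolSharpM D hlog t tq M archPk archSub Ψ act Mmod region n lat sig split qData htq0 Sq htq1).negLogTheta :=
  negLogTheta_settingMSharp_eq D hlog M archPk archSub Ψ act Mmod region n lat sig split qData t tq htq0 Sq htq1

/-- The local `−|log(Θ)|` agree on the two routes. [claim: Mochizuki2012, status: disputed] -/
theorem thetaLocal_settingMSharp_eq_settingPrVolSharpM (j : (thetaIndexOfInitial D).Label)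
    (vQ : (thetaIndexOfInitial D).VQ) :
    (settingMSharp D hlog M archPk archSub Ψ act Mmod region n lat sig split qData t tq htq0 Sq htq1).thetaLocal j vQ =
      (settingPrVolSharpM D hlog t tq M archPk archSub Ψ act Mmod region n lat sig split qData htq0 Sq htq1).thetaLocal
        j vQ :=
  thetaLocal_settingMSharp_eq D hlog M archPk archSub Ψ act Mmod region n lat sig split qData t tq htq0 Sq htq1 j vQ

/-- `ThetaFinite` agrees on the two routes. [claim: Mochizuki2012, status: disputed] -/
theorem thetaFinite_settingMSharp_iff_settingPrVolSharpM :
    (settingMSharp D hlog M archPk archSub Ψ act Mmod region n lat sig split qData t tq htq0 Sq htq1).ThetaFinite ↔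
      (settingPrVolSharpM D hlog t tq M archPk archSub Ψ act Mmod region n lat sig split qData htq0 Sq htq1).ThetaFinite :=
  thetaFinite_settingMSharp_iff D hlog M archPk archSub Ψ act Mmod region n lat sig split qData t tq htq0 Sq htq1

/-- The printed `Statement` agrees on the two routes. [claim: Mochizuki2012, status: disputed] -/
theorem statement_settingMSharp_iff_settingPrVolSharpM :
    (settingMSharp D hlog M archPk archSub Ψ act Mmod region n lat sig split qData t tq htq0 Sq htq1).Statement ↔
      (settingPrVolSharpM D hlog t tq M archPk archSub Ψ act Mmod region n lat sig split qData htq0 Sq htq1).Statement :=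
  statement_settingMSharp_iff D hlog M archPk archSub Ψ act Mmod region n lat sig split qData t tq htq0 Sq htq1

/-- **Every Kummer image of the Θ-pilot object is the preimage of the (constant-in-`m`) sharp Θ-box** (Dupuy–Hilado §4.10;
twin of abc-iut-c312-7's `thetaRegion_sharp_Pr`). [cite: DupuyHilado2025, §4.10] -/
theorem thetaRegion_settingPrVolSharpM (m : ℤ) (j : (thetaIndexOfInitial D).Label) (vQ : (thetaIndexOfInitial D).VQ) :
    (settingPrVolSharpM D hlog t tq M archPk archSub Ψ act Mmod region n lat sig split qData htq0 Sq htq1).thetaRegion m j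
        vQ = factorMapM D hlog j vQ ⁻¹' thetaBoxM D hlog t j vQ :=
  rfl

/-- The `q`-image is the preimage of the hull-set of the `q`-centre. [cite: DupuyHilado2025, §3.9] -/
theorem qRegion_settingPrVolSharpM (j : (thetaIndexOfInitial D).Label) (vQ : (thetaIndexOfInitial D).VQ) :
    (settingPrVolSharpM D hlog t tq M archPk archSub Ψ act Mmod region n lat sig split qData htq0 Sq htq1).qRegion j vQ =
      factorMapM D hlog j vQ ⁻¹' hullSet (factorFieldM D hlog j vQ) (qCentreM D hlog tq j vQ) :=
  rfl

/-- **The (Ind3)-enlarged Θ-region IS the preimage of the single sharp box** (the union over `m` of a constant family).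
[cite: DupuyHilado2025, §4.10] -/
theorem thetaRegion3_settingPrVolSharpM (j : (thetaIndexOfInitial D).Label) (vQ : (thetaIndexOfInitial D).VQ) :
    (settingPrVolSharpM D hlog t tq M archPk archSub Ψ act Mmod region n lat sig split qData htq0 Sq htq1).thetaRegion3 j
        vQ = factorMapM D hlog j vQ ⁻¹' thetaBoxM D hlog t j vQ := by
  ext x
  rw [Setting.thetaRegion3, Set.mem_iUnion]
  exact ⟨fun ⟨_, h⟩ => h, fun h => ⟨0, h⟩⟩

/-- **`hθ` PROVED for the summand-route sharp setting**: the (Ind3)-enlarged Θ-region is ADMISSIBLE in the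
packet-normalised container at every `(j, v_ℚ)` (at a finite place a direct product over the summands of nondegenerate
translates of `(R_I)^∼`, [IUTchIII] Rmk. 3.1.1 (iii); at `∞` everything). [claim: Mochizuki2012, status: disputed] -/
theorem adm_thetaRegion3_settingPrVolSharpM (ht0 : ∀ u i x, t u i x ≠ 0) (j : (thetaIndexOfInitial D).Label)
    (vQ : (thetaIndexOfInitial D).VQ) :
    ((situationPrVolM D hlog M archPk archSub Ψ act Mmod region).D n).Adm j vQ
      ((settingPrVolSharpM D hlog t tq M archPk archSub Ψ act Mmod region n lat sig split qData htq0 Sq htq1).thetaRegion3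
        j vQ) := by
  rw [thetaRegion3_settingPrVolSharpM]
  rcases vQ with w | u
  · refine (LocalPieces.adm_trivial_iff (logShellsOfInitialDH D logvK) _ j _).2 ⟨0, ?_⟩
    exact Set.mem_univ _
  · exact (presAtM D hlog u).adm_preimage_boxOf_sharpBox (t u) (ht0 u) j

/-- **The packet-normalised local Θ-volume at `(i+1, u)` in CLOSED FORM**: `Σ_{v⃗} Pr(v⃗)·log ‖t_{Θ,i+1,v̲_{i+1}}‖`
(Dupuy–Hilado (3.7) summand by summand, weighted by the `V_mod` probability weights `weightM`; [IUTchIII] Rmk. 3.1.1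
(ii); twin of abc-iut-c312-7's `logvol_thetaRegion3_sharp_Pr_inr`). [cite: DupuyHilado2025, §3.6, §3.7, §3.9] -/
theorem logvol_thetaRegion3_settingPrVolSharpM_non (ht0 : ∀ u i x, t u i x ≠ 0) (i : Fin (thetaIndexOfInitial D).lstar)
    (u : FinitePlace ℚ) :
    ((situationPrVolM D hlog M archPk archSub Ψ act Mmod region).D n).logvol (Setting.labelSucc i) (Val.non u)
      ((settingPrVolSharpM D hlog t tq M archPk archSub Ψ act Mmod region n lat sig split qData htq0 Sq htq1).thetaRegion3
        (Setting.labelSucc i) (Val.non u)) =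
      ∑ e : (presAtM D hlog u).toLocalPieces.E (Setting.labelSucc i),
        weightM D u (Setting.labelSucc i) e * Real.log ‖t u i (e (Fin.last _))‖ := by
  rw [thetaRegion3_settingPrVolSharpM]
  have h := (presAtM D hlog u).factorMap_preimage_boxOf (sharpBoxM D hlog t u (Setting.labelSucc i))
  have key := SummandPieces.logvol_preimage_pi (summandPiecesPrM D hlog) (Setting.labelSucc i) (Val.non u)
    (R := sharpBoxM D hlog t u (Setting.labelSucc i)) (packetAdm_sharpBoxM D hlog t ht0 u (Setting.labelSucc i))
  change (summandPiecesPrM D hlog).logvol (Setting.labelSucc i) (Val.non u)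
    ((fun x => (presAtM D hlog u).factorMap (Setting.labelSucc i) x) ⁻¹'
      (presAtM D hlog u).boxOf (sharpBoxM D hlog t u (Setting.labelSucc i))) = _
  rw [h]
  refine key.trans (Finset.sum_congr rfl fun e _ => ?_)
  show weightM D u (Setting.labelSucc i) e * packetLogμ (ratChar u) ((presAtM D hlog u).kk e) _ = _
  rw [packetLogμ_sharpBoxM_labelSucc D hlog t ht0 u i e]

/-- The support of `v_ℚ ↦` local Θ-volume at `(i+1, v_ℚ)` lies in any finite set `Sθ` of rational places off which the
Θ-ideles are units. [folklore] -/
theorem support_logvol_thetaRegion3_settingPrVolSharpM_subset (ht0 : ∀ u i x, t u i x ≠ 0) (Sθ : Finset (FinitePlace ℚ))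
    (ht1 : ∀ (u : FinitePlace ℚ) (i : Fin (thetaIndexOfInitial D).lstar) (x : (thetaIndexOfInitial D).Fibre (Val.non u)),
      u ∉ Sθ → ‖t u i x‖ = 1)
    (i : Fin (thetaIndexOfInitial D).lstar) :
    (Function.support fun vQ : (thetaIndexOfInitial D).VQ =>
      ((situationPrVolM D hlog M archPk archSub Ψ act Mmod region).D n).logvol _ vQ
        ((settingPrVolSharpM D hlog t tq M archPk archSub Ψ act Mmod region n lat sig split qData htq0 Sq
          htq1).thetaRegion3 (Setting.labelSucc i) vQ)) ⊆ Val.non '' (Sθ : Set (FinitePlace ℚ)) := by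
  intro vQ hvQ
  rw [Function.mem_support] at hvQ
  rcases vQ with w | u
  · exact absurd (logvol_situationPrVolM_arc D hlog M archPk archSub Ψ act Mmod region n w _ _) hvQ
  · refine ⟨u, ?_, rfl⟩
    by_contra hu
    exact hvQ ((logvol_thetaRegion3_settingPrVolSharpM_non D hlog t tq M archPk archSub Ψ act Mmod region n lat sig split
      qData htq0 Sq htq1 ht0 i u).trans
      (Finset.sum_eq_zero fun e _ => by rw [ht1 u i _ hu, Real.log_one, mul_zero]))

/-- **`hfinθ` PROVED for the summand-route sharp setting**: for Θ-ideles that are units off a finite set `Sθ` of rational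
places (the genuine ideles: off the places under `V^bad_mod`), the local Θ-volume at every label `j = i+1` is finitely
supported over `V_ℚ` ([IUTchIII] Prop. 3.9 (iii)). [claim: Mochizuki2012, status: disputed] -/
theorem finite_support_logvol_thetaRegion3_settingPrVolSharpM (ht0 : ∀ u i x, t u i x ≠ 0) (Sθ : Finset (FinitePlace ℚ))
    (ht1 : ∀ (u : FinitePlace ℚ) (i : Fin (thetaIndexOfInitial D).lstar) (x : (thetaIndexOfInitial D).Fibre (Val.non u)),
      u ∉ Sθ → ‖t u i x‖ = 1)
    (i : Fin (thetaIndexOfInitial D).lstar) :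
    (Function.support fun vQ : (thetaIndexOfInitial D).VQ =>
      ((situationPrVolM D hlog M archPk archSub Ψ act Mmod region).D n).logvol _ vQ
        ((settingPrVolSharpM D hlog t tq M archPk archSub Ψ act Mmod region n lat sig split qData htq0 Sq
          htq1).thetaRegion3 (Setting.labelSucc i) vQ)).Finite :=
  (Sθ.finite_toSet.image _).subset (support_logvol_thetaRegion3_settingPrVolSharpM_subset D hlog t tq M archPk archSub Ψ
    act Mmod region n lat sig split qData htq0 Sq htq1 ht0 Sθ ht1 i)

/-- **The packet-normalised local `q`-volume at `(j, u)` in CLOSED FORM**: `Σ_{v⃗} Pr(v⃗)·log ‖t_{q,v̲_j}‖` (`λ_q·𝒪_L` pulls back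
to `Π_{v⃗} ι_j(t_{q,v̲_j})·(R_I)^∼`, Dupuy–Hilado §3.9; (3.7); twin of abc-iut-c312-7's `logvol_qRegion_Pr_inr`).
[cite: DupuyHilado2025, §3.6, §3.7, §3.9] -/
theorem logvol_qRegion_settingPrVolSharpM_non (j : (thetaIndexOfInitial D).Label) (u : FinitePlace ℚ) :
    ((situationPrVolM D hlog M archPk archSub Ψ act Mmod region).D n).logvol j (Val.non u)
      ((settingPrVolSharpM D hlog t tq M archPk archSub Ψ act Mmod region n lat sig split qData htq0 Sq htq1).qRegion j
        (Val.non u)) =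
      ∑ e : (presAtM D hlog u).toLocalPieces.E j, weightM D u j e * Real.log ‖tq u (e (Fin.last _))‖ := by
  rw [qRegion_settingPrVolSharpM]
  have h := (presAtM D hlog u).factorMap_preimage_hullSet_qCentre (tq u) (htq0 u) j
  have key := SummandPieces.logvol_preimage_pi (summandPiecesPrM D hlog) j (Val.non u)
    ((presAtM D hlog u).packetAdm_qBox (tq u) (htq0 u) j)
  change (summandPiecesPrM D hlog).logvol j (Val.non u)
    ((fun x => (presAtM D hlog u).factorMap j x) ⁻¹'
      hullSet ((presAtM D hlog u).factorField j) ((presAtM D hlog u).qCentre (tq u) j)) = _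
  rw [h]
  refine key.trans (Finset.sum_congr rfl fun e _ => ?_)
  show weightM D u j e * packetLogμ (ratChar u) ((presAtM D hlog u).kk e) _ = _
  exact congrArg (fun r : ℝ => weightM D u j e * r) ((presAtM D hlog u).packetLogμ_qBox (tq u) (htq0 u) j e)

/-- **abc-iut-c312-6's `BridgeHyps` for the summand-route M-level sharp setting, from `ThetaFinite` ALONE**: `mono`,
`image_adm`, `image_fin`, `hul_nonempty`, `theta_nonempty` (abc-iut-w4-d013 `bridgeHyps_settingPrVolM`) and `hθ`, `hfinθ`
(this file) are DISCHARGED for Θ-ideles that are non-zero and units off a finite set of rational places; the remaining input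
`ThetaFinite` ("`−|log(Θ)| ∈ ℝ`") is unit P5 (abc-iut-s2-p9 `thetaFinite_ofFramesM` through the two-routes bridge).
[claim: Mochizuki2012, status: disputed] -/
theorem bridgeHyps_settingPrVolSharpM (ht0 : ∀ u i x, t u i x ≠ 0) (Sθ : Finset (FinitePlace ℚ))
    (ht1 : ∀ (u : FinitePlace ℚ) (i : Fin (thetaIndexOfInitial D).lstar) (x : (thetaIndexOfInitial D).Fibre (Val.non u)),
      u ∉ Sθ → ‖t u i x‖ = 1)
    (finite : (settingPrVolSharpM D hlog t tq M archPk archSub Ψ act Mmod region n lat sig split qData htq0 Sq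
      htq1).ThetaFinite) :
    BridgeHyps (settingPrVolSharpM D hlog t tq M archPk archSub Ψ act Mmod region n lat sig split qData htq0 Sq htq1) :=
  bridgeHyps_settingPrVolM D hlog M archPk archSub Ψ act Mmod region n lat sig split qData _ _ _ _
    (fun _ vQ => adm_thetaRegion3_settingPrVolSharpM D hlog t tq M archPk archSub Ψ act Mmod region n lat sig split qData
      htq0 Sq htq1 ht0 _ vQ)
    (fun i => finite_support_logvol_thetaRegion3_settingPrVolSharpM D hlog t tq M archPk archSub Ψ act Mmod region n lat
      sig split qData htq0 Sq htq1 ht0 Sθ ht1 i)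
    finite

/-- **`ThetaFinite` ("`−|log(Θ)| ∈ ℝ`") for the summand-route M-level sharp setting**, for non-zero Θ-ideles that are
units off a finite set `Sθ` of rational places — abc-iut-s2-p9's `thetaFinite_settingMSharp` (unit P5b, p437661) carried
along abc-iut-w4-d013's two-routes identity. The M-level twin of abc-iut-c312-7's `thetaFinite_settingPrVolSharp`.
[claim: Mochizuki2012, status: disputed] -/
theorem thetaFinite_settingPrVolSharpM (ht0 : ∀ u i x, t u i x ≠ 0) (Sθ : Finset (FinitePlace ℚ))
    (ht1 : ∀ (u : FinitePlace ℚ) (i : Fin (thetaIndexOfInitial D).lstar) (x : (thetaIndexOfInitial D).Fibre (Val.non u)),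
      u ∉ Sθ → ‖t u i x‖ = 1) :
    (settingPrVolSharpM D hlog t tq M archPk archSub Ψ act Mmod region n lat sig split qData htq0 Sq htq1).ThetaFinite :=
  (thetaFinite_settingMSharp_iff_settingPrVolSharpM D hlog t tq M archPk archSub Ψ act Mmod region n lat sig split qData
    htq0 Sq htq1).1
    (thetaFinite_settingMSharp D hlog M archPk archSub Ψ act Mmod region n lat sig split qData t tq htq0 Sq htq1 ht0 Sθ ht1)

/-- Hence **`−|log(Θ)| ≠ +∞`** for the summand-route M-level sharp setting. [claim: Mochizuki2012, status: disputed] -/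
theorem negLogTheta_settingPrVolSharpM_ne_top (ht0 : ∀ u i x, t u i x ≠ 0) (Sθ : Finset (FinitePlace ℚ))
    (ht1 : ∀ (u : FinitePlace ℚ) (i : Fin (thetaIndexOfInitial D).lstar) (x : (thetaIndexOfInitial D).Fibre (Val.non u)),
      u ∉ Sθ → ‖t u i x‖ = 1) :
    (settingPrVolSharpM D hlog t tq M archPk archSub Ψ act Mmod region n lat sig split qData htq0 Sq htq1).negLogTheta ≠ ⊤ := by
  unfold Setting.negLogTheta
  rw [if_pos (thetaFinite_settingPrVolSharpM D hlog t tq M archPk archSub Ψ act Mmod region n lat sig split qData htq0 Sq htq1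
    ht0 Sθ ht1)]
  exact WithTop.coe_ne_top

/-- **abc-iut-c312-6's `BridgeHyps` for the summand-route M-level sharp setting — EVERY FIELD A THEOREM** (`mono`,
`image_adm`, `image_fin`, `hul_nonempty`, `theta_nonempty` by abc-iut-w4-d013 `bridgeHyps_settingPrVolM`; `hθ`, `hfinθ` here;
`ThetaFinite` by abc-iut-s2-p9 through the two-routes identity). Left: only the idele binders (Θ-ideles non-zero and units
off a finite set of rational places; `q`-ideles likewise) — for the genuine ideles of a Θ-volume input every one of them is
a theorem (abc-iut-w5-d033 `tThetaM_ne_zero` / `tqM_ne_zero` / `norm_tThetaM_eq_one_of_not_mem` / `norm_tqM_eq_one_of_not_mem`).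
The M-level twin of abc-iut-c312-7's `bridgeHyps_settingPrVolSharp_of_ideles`. [claim: Mochizuki2012, status: disputed] -/
theorem bridgeHyps_settingPrVolSharpM_of_ideles (ht0 : ∀ u i x, t u i x ≠ 0) (Sθ : Finset (FinitePlace ℚ))
    (ht1 : ∀ (u : FinitePlace ℚ) (i : Fin (thetaIndexOfInitial D).lstar) (x : (thetaIndexOfInitial D).Fibre (Val.non u)),
      u ∉ Sθ → ‖t u i x‖ = 1) :
    BridgeHyps (settingPrVolSharpM D hlog t tq M archPk archSub Ψ act Mmod region n lat sig split qData htq0 Sq htq1) :=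
  bridgeHyps_settingPrVolSharpM D hlog t tq M archPk archSub Ψ act Mmod region n lat sig split qData htq0 Sq htq1 ht0 Sθ ht1
    (thetaFinite_settingPrVolSharpM D hlog t tq M archPk archSub Ψ act Mmod region n lat sig split qData htq0 Sq htq1 ht0 Sθ
      ht1)

end Setting

end Summit.ABC.IUTFork.Thm311.Real

end
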